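import Literature.MathematicalPhysics.QuantumFieldTheory.King1986.MinimizerAliasModes
import Literature.MathematicalPhysics.QuantumFieldTheory.King1986.MinimizerFourier
import HarnessLib

/-!
# King 1986 (4.2)/(4.19) — THE TORUS ↔ MOMENTUM DICTIONARY: the alias fibres of the finite torus are King's digit sets
# `{l ∈ 2πℤ^d : |l_μ| ≦ π(L^k − 1)}`, and the torus modes of `EffectiveLaplacianSymbol` ARE the momentum-space modes of
# `MinimizerAliasModes` (`u = conj u^η_k`, `σ = Δ^η + m²`, `e^{ip·x} = e^{iQ·ξ}`, `Δ_eff = Δ^{(k)}`)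

**Citation header (reproduction of PUBLISHED work; seat `pub-ymgap-dag-n18-b` of the cell `pub-ymgap`, Track-A node
N18 = NE5 whose PRINTED MODEL of record is King's Prop. 3.8; fourth file of the seat's Prop-3.8 programme after
`MinimizerAliasModes` (p409438), `MinimizerFourier` (p409751), `MinimizerAliasRate`; typing + bookkeeping of the printed
index conventions — no estimate is proved here).**
C. King, *The U(1) Higgs model. I. The continuum limit*, Commun. Math. Phys. **102** (1986) 649–677 [King1986], §4 p. 670
(4.1)–(4.5) and p. 672 (4.19).  Page images READ AS IMAGES by this seat: `b2b-balaban-template/king-renders/1986-cmp102-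
king-u1-higgs-I-p022-x2.png` (p. 670), `…-p024-x2.png` (p. 672).  Index convention of the aliases: T. Bałaban,
*Propagators and renormalization transformations for lattice gauge theories. I*, Commun. Math. Phys. **95** (1984) 17–40
[Balaban1984PropagatorsI], (1.31) p. 23 (the `p = p′ + l` parametrisation; tree `B5Block118.pOf`, `red`, `fib`).

**What King prints (verbatim).**  p. 670: «(a_kG_kQ^*_k)(x, y) = (2π)^{−d} ∫_{|p′|≦π} dp′ Δ^{(k)}(p′) Σ_l e^{i(p′+l)(x−y)}
u^η_k(p′+l)/Δ^η(p′+l), (4.2) where x ∈ ηZ^d, y ∈ Z^d, p′ ∈ [−π, π), l ∈ 2πZ^d and −π(L^k − 1) ≦ l_μ ≦ π(L^k − 1) for L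
odd, while −πL^k ≦ l_μ ≦ πL^k for L even. Also u^η_k(p) = Π_{μ=1}^d [(e^{−ip_μ} − 1)η(e^{−iηp_μ} − 1)^{−1}], (4.3)
Δ^η(p) = 4η^{−2} Σ_{μ=1}^d sin²(1/2ηp_μ) + m²(L^kε)², (4.4)».  p. 672: «where l ∈ 2πZ^d is the same as in (4.2). Also
m ∈ 2πL^kZ^d and |m_μ| ≦ πL^k(L^n − 1) for L odd».

**What this file PROVES (kernel; `N` = King's `L^k` and ODD where stated; unit torus `Ω = Tor M`, fine torus
`Ω_η = Tor (fine N M)`, reduced momentum `p′ = sOf M q ∈ (−π, π]^d` of `q ∈ Ω̂`).**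
* §1 `chi_eq_cexp_sOf`: the torus characters in exponential form `e^{ip·x} = exp(iΣ_μ θ_μ(p)·x_μ)`, `θ = sOf p`.
* §2 THE DIGITS: `digitBox d N = {j : |j_μ| ≤ N/2}` (= King's `|l_μ| ≦ π(N−1)` for odd `N`; `card = N^d`;
  `2|j_μ| < N` ⇔ membership), `digit q p = (v(p) − v(q))/M` (`v` = centred residue) and `aliasMom q w = v(q) + Mw mod NM`:
  on the fibre `fib q` they are MUTUALLY INVERSE (`aliasMom_digit`, `digit_aliasMom`, `valMinAbs_aliasMom`,
  `valMinAbs_eq_of_mem_fib`), the digits of a fibre element are King's (`two_abs_digit_lt`: `2|j_μ| < N`, odd `N`, from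
  `−NM < 2v(p) ≤ NM`, `−M < 2v(q) ≤ M` and parity), hence **`sum_fib_eq_sum_digitBox`**:
  `Σ_{p ∈ fib q} g(p) = Σ_{w ∈ digitBox} g(aliasMom q w)` — the torus alias fibre IS King's `Σ_l`.
* §3 THE DICTIONARY on the fibre (`Q := p′ + 2π·digit p = N·θ(p)`, `natMul_sOf_fine_eq_aliasPt`):
  `chi_fine_eq_modePhase` (`e^{ip·x} = modePhase Q (x/N)`), `lapSym_fine_eq_latticeSymbol` (for `c = N²`:
  `σ(p) = latticeSymbol N⁻¹ m² Q` = (4.4)), **`u_eq_conj_uWeight`** (`u(p) = conj (uWeight N⁻¹ Q)` = (4.3) conjugated: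
  the block average of a character is the geometric sum `N⁻¹(e^{iNθ} − 1)/(e^{iθ} − 1)`, `avgChar_eq_conj_uFac`).
* §4 `torusMode_eq_modeTerm` (with `effSym_eq_DeltaEff`: each torus mode of `MinimizerFourier.minimiser_kernel_eq_sum` is
  `e^{−iq·b}·modeTerm (Δ^{(k)}(p′)) N⁻¹ m² Q ξ`), and **`minimiser_kernel_eq_digitSum`**: for odd `N`, `c = N²`, `a > 0`,
  `m² > 0`, `ℋ_k(x, b) = |Ω|⁻¹ Σ_q e^{−iq·b} Σ_{j ∈ digitBox} modeTerm (Δ^{(k)}(p′)) N⁻¹ m² (p′ + 2πj) (x/N)` — (4.2)/(4.19)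
  for the ACTUAL torus operators with King's index set.
* §5 TWO LEVELS (`sum_digitBox_mul`): for odd `N`, `R`, `Σ_{w ∈ digitBox(NR)} F(w) = Σ_{j ∈ digitBox N} Σ_{b ∈ digitBox R}
  F(j + Nb)` — the aliases of the finer lattice (`η′ = (NR)⁻¹`) re-indexed as `l + m` exactly as in (4.19) (injectivity =
  `AliasSums.digits_injective_pi`, surjectivity by the count `N^dR^d = (NR)^d`).

**NOT COVERED.**  Even `N` (King's shifted `m`-lattice), the two-spacing estimate itself (sequel: `MinimizerAliasRate`
momentum-space + this dictionary ⇒ Prop. 3.8 on the torus), `A ≠ 0`.  HONEST FRAMING: bookkeeping for King's `A = 0`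
scalar MODEL on a finite torus (template literature); nothing about Bałaban's covariant objects; nothing continuum ∕
mass-gap ∕ Clay; count-neutral for the cell's 27 nodes.
-/

noncomputable section

open Finset Real Matrix
open scoped BigOperators ComplexConjugate

namespace Literature.MathematicalPhysics.QuantumFieldTheory.King1986

open Literature.MathematicalPhysics.QuantumFieldTheory.Balaban1983to89
open Literature.MathematicalPhysics.QuantumFieldTheory.Balaban1983to89.B5Prop11Plancherel

namespace Torus

variable {d : ℕ}

/-! ## §1 Characters in exponential form -/

section Characters

variable (K : Fin d → ℕ) [hK : ∀ μ, NeZero (K μ)]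

/-- One factor of a torus character in exponential form through the centred residue:
`χ(a·x) = exp(i·(2πv(a)/K)·val x)`. [cite: King1986, (4.1) p.670] -/
theorem stdAddChar_mul_eq_cexp (μ : Fin d) (a x : ZMod (K μ)) :
    (ZMod.stdAddChar (N := K μ) (a * x) : ℂ)
      = Complex.exp (Complex.I * ((2 * π * (a.valMinAbs : ℝ) / (K μ : ℝ) * (x.val : ℝ) : ℝ) : ℂ)) := by
  have h1 : a * x = (((a.valMinAbs * (x.val : ℤ) : ℤ)) : ZMod (K μ)) := by
    push_cast
    rw [ZMod.natCast_zmod_val]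
  rw [h1, ZMod.stdAddChar_coe]
  congr 1
  push_cast
  ring

/-- **The torus characters are the plane waves of the reduced momenta**: `e^{ip·x} = exp(i Σ_μ p′_μ·x_μ)` with
`p′ = sOf p ∈ (−π, π]^d` and `x_μ` the integer coordinates. [cite: King1986, (4.1) p.670] -/
theorem chi_eq_cexp_sOf (p x : Tor K) :
    chi K p x = Complex.exp (Complex.I * ((∑ μ, sOf K p μ * ((x μ).val : ℝ) : ℝ) : ℂ)) := by
  unfold chi
  simp_rw [stdAddChar_mul_eq_cexp K]
  rw [← Complex.exp_sum]
  congr 1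
  push_cast
  rw [Finset.mul_sum]
  refine Finset.sum_congr rfl fun μ _ => ?_
  simp only [sOf]
  push_cast
  ring

end Characters

/-! ## §2 The symmetric digits of an alias fibre (`l ∈ 2πℤ^d`, `|l_μ| ≤ π(L^k − 1)`, `L` odd) -/

section Digits

variable (N : ℕ) [NeZero N] (M : Fin d → ℕ) [hM : ∀ μ, NeZero (M μ)]

/-- King's digit set `{j ∈ ℤ^d : |j_μ| ≤ (N−1)/2}` (the aliases `l = 2πj`, `|l_μ| ≤ π(N − 1)`, `N = L^k` odd).
[cite: King1986, (4.2) p.670] -/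
def digitBox (dd N : ℕ) : Finset (Fin dd → ℤ) :=
  Fintype.piFinset fun _ : Fin dd => Finset.Icc (-((N / 2 : ℕ) : ℤ)) ((N / 2 : ℕ) : ℤ)

omit [NeZero N] in
/-- Membership in the digit box. [cite: King1986, (4.2) p.670] -/
theorem mem_digitBox {j : Fin d → ℤ} : j ∈ digitBox d N ↔ ∀ μ, |j μ| ≤ ((N / 2 : ℕ) : ℤ) := by
  simp only [digitBox, Fintype.mem_piFinset, Finset.mem_Icc, abs_le]

omit [NeZero N] in
/-- For odd `N` the digits satisfy `2|j_μ| < N` (the strict digit condition of `AliasSums.digits_injective`).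
[cite: King1986, (4.2) p.670] -/
theorem two_abs_lt_of_mem_digitBox (hN : Odd N) {j : Fin d → ℤ} (hj : j ∈ digitBox d N) (μ : Fin d) :
    2 * |j μ| < (N : ℤ) := by
  have h := (mem_digitBox N).mp hj μ
  obtain ⟨t, ht⟩ := hN
  have hdiv : N / 2 = t := by omega
  rw [hdiv] at h
  have : (N : ℤ) = 2 * t + 1 := by exact_mod_cast ht
  omega

omit [NeZero N] in
/-- Conversely `2|j_μ| < N` for all `μ` puts `j` in the digit box. [cite: King1986, (4.2) p.670] -/
theorem mem_digitBox_of_two_abs_lt {j : Fin d → ℤ} (hj : ∀ μ, 2 * |j μ| < (N : ℤ)) : j ∈ digitBox d N := by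
  refine (mem_digitBox N).mpr fun μ => ?_
  have h := hj μ
  have : ((N / 2 : ℕ) : ℤ) = (N : ℤ) / 2 := by omega
  omega

omit [NeZero N] in
/-- The digit box of an odd `N` has `N^d` elements. [cite: King1986, (4.2) p.670] -/
theorem card_digitBox (hN : Odd N) : (digitBox d N).card = N ^ d := by
  unfold digitBox
  rw [Fintype.card_piFinset, Finset.prod_const, Finset.card_univ, Fintype.card_fin, Int.card_Icc]
  congr 1
  obtain ⟨t, ht⟩ := hN
  have hdiv : N / 2 = t := by omega
  rw [hdiv]; omega

/-- THE DIGIT of an alias: for `p` in the fibre of `q`, `j_μ(p) = (v(p_μ) − v(q_μ))/M_μ` with `v` the centred residue —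
the integer vector with `p′ + 2πj = N·θ(p)` (`θ` the fine reduced momentum). [cite: King1986, (4.2) p.670] -/
def digit (q : Tor M) (p : Tor (fine N M)) : Fin d → ℤ :=
  fun μ => (((p μ).valMinAbs - (q μ).valMinAbs) / (M μ : ℤ))

/-- THE ALIAS MOMENTUM of a digit: `w ↦ (v(q_μ) + M_μ w_μ mod NM_μ)_μ` — the point `p′ + 2πw` of the fine
Brillouin zone. [cite: King1986, (4.2) p.670; Balaban1984PropagatorsI, (1.31) p.23] -/
def aliasMom (q : Tor M) (w : Fin d → ℤ) : Tor (fine N M) :=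
  fun μ => ((((q μ).valMinAbs + (M μ : ℤ) * w μ : ℤ)) : ZMod (fine N M μ))

omit [NeZero N] hM in
/-- The alias momentum of any digit reduces to `q`. [cite: King1986, (4.2) p.670] -/
theorem red_aliasMom (q : Tor M) (w : Fin d → ℤ) : red N M (aliasMom N M q w) = q := by
  funext μ
  simp only [red, aliasMom]
  rw [map_intCast, Int.cast_add, ZMod.coe_valMinAbs, Int.cast_mul, Int.cast_natCast, ZMod.natCast_self,
    zero_mul, add_zero]

/-- Hence it lies in the fibre of `q`. [cite: King1986, (4.2) p.670] -/
theorem aliasMom_mem_fib (q : Tor M) (w : Fin d → ℤ) : aliasMom N M q w ∈ fib N M q := by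
  simp [fib, red_aliasMom]

/-- In the fibre of `q`, `M_μ` divides `v(p_μ) − v(q_μ)` (both residues represent `p_μ` modulo `M_μ`).
[cite: Balaban1984PropagatorsI, (1.31) p.23] -/
theorem dvd_valMinAbs_sub {q : Tor M} {p : Tor (fine N M)} (hp : p ∈ fib N M q) (μ : Fin d) :
    (M μ : ℤ) ∣ (p μ).valMinAbs - (q μ).valMinAbs := by
  have hq : red N M p = q := by simpa [fib] using hp
  have h1 : (((p μ).valMinAbs : ℤ) : ZMod (M μ)) = (((q μ).valMinAbs : ℤ) : ZMod (M μ)) := by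
    rw [ZMod.coe_valMinAbs, ← hq]
    simp only [red]
    rw [← ZMod.coe_valMinAbs (p μ), map_intCast, ZMod.coe_valMinAbs]
  exact (ZMod.intCast_eq_intCast_iff_dvd_sub _ _ _).mp h1.symm

/-- The centred residue of a fibre element is `v(q_μ) + M_μ·digit_μ`. [cite: King1986, (4.2) p.670] -/
theorem valMinAbs_eq_of_mem_fib {q : Tor M} {p : Tor (fine N M)} (hp : p ∈ fib N M q) (μ : Fin d) :
    ((p μ).valMinAbs : ℤ) = (q μ).valMinAbs + (M μ : ℤ) * digit N M q p μ := by
  have h := Int.ediv_mul_cancel (dvd_valMinAbs_sub N M hp μ)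
  simp only [digit]
  linarith [h, mul_comm ((((p μ).valMinAbs - (q μ).valMinAbs) / (M μ : ℤ))) (M μ : ℤ)]

/-- `aliasMom (digit p) = p` on the fibre. [cite: King1986, (4.2) p.670] -/
theorem aliasMom_digit {q : Tor M} {p : Tor (fine N M)} (hp : p ∈ fib N M q) :
    aliasMom N M q (digit N M q p) = p := by
  funext μ
  simp only [aliasMom]
  rw [← valMinAbs_eq_of_mem_fib N M hp μ, ZMod.coe_valMinAbs]

/-- **The digits of a fibre element are King's**: `2|j_μ| < N` for odd `N` (from `−NM < 2v(p) ≤ NM`, `−M < 2v(q) ≤ M`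
and parity). [cite: King1986, (4.2) p.670 («−π(L^k − 1) ≦ l_μ ≦ π(L^k − 1) for L odd»)] -/
theorem two_abs_digit_lt (hN : Odd N) {q : Tor M} {p : Tor (fine N M)} (hp : p ∈ fib N M q) (μ : Fin d) :
    2 * |digit N M q p μ| < (N : ℤ) := by
  have hv := valMinAbs_eq_of_mem_fib N M hp μ
  have hpI := ZMod.valMinAbs_mem_Ioc (p μ)
  have hqI := ZMod.valMinAbs_mem_Ioc (q μ)
  simp only [Set.mem_Ioc, fine, Nat.cast_mul] at hpI hqI
  have hM : (0 : ℤ) < (M μ : ℤ) := by exact_mod_cast Nat.pos_of_ne_zero (NeZero.ne (M μ))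
  set j := digit N M q p μ with hj
  obtain ⟨t, ht⟩ := hN
  have hNt : (N : ℤ) = 2 * t + 1 := by exact_mod_cast ht
  -- `M·(2j) < M·(N+1)` and `M·(2j) > −M·(N+1)`
  have hup : (M μ : ℤ) * (2 * j) < (M μ : ℤ) * ((N : ℤ) + 1) := by nlinarith
  have hlo : (M μ : ℤ) * (-((N : ℤ) + 1)) < (M μ : ℤ) * (2 * j) := by nlinarith
  have h1 : 2 * j < (N : ℤ) + 1 := lt_of_mul_lt_mul_left hup hM.le
  have h2 : -((N : ℤ) + 1) < 2 * j := lt_of_mul_lt_mul_left hlo hM.le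
  rcases abs_cases j with ⟨h, _⟩ | ⟨h, _⟩ <;> rw [h] <;> omega

/-- Hence the digit vector lies in the digit box. [cite: King1986, (4.2) p.670] -/
theorem digit_mem_digitBox (hN : Odd N) {q : Tor M} {p : Tor (fine N M)} (hp : p ∈ fib N M q) :
    digit N M q p ∈ digitBox d N :=
  mem_digitBox_of_two_abs_lt N fun μ => two_abs_digit_lt N M hN hp μ

/-- The centred residue of `aliasMom q w` IS `v(q) + Mw` for a digit `w` (it lies in `(−NM/2, NM/2]`).
[cite: King1986, (4.2) p.670] -/
theorem valMinAbs_aliasMom (hN : Odd N) (q : Tor M) {w : Fin d → ℤ} (hw : w ∈ digitBox d N) (μ : Fin d) :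
    ((aliasMom N M q w μ).valMinAbs : ℤ) = (q μ).valMinAbs + (M μ : ℤ) * w μ := by
  rw [ZMod.valMinAbs_spec]
  refine ⟨rfl, ?_⟩
  have hqI := ZMod.valMinAbs_mem_Ioc (q μ)
  have hwμ := two_abs_lt_of_mem_digitBox N hN hw μ
  simp only [Set.mem_Ioc, fine, Nat.cast_mul] at hqI ⊢
  have hM : (0 : ℤ) < (M μ : ℤ) := by exact_mod_cast Nat.pos_of_ne_zero (NeZero.ne (M μ))
  obtain ⟨t, ht⟩ := hN
  have hNt : (N : ℤ) = 2 * t + 1 := by exact_mod_cast ht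
  have hw1 : -(t : ℤ) ≤ w μ := by
    rcases abs_cases (w μ) with ⟨h, _⟩ | ⟨h, _⟩ <;> rw [h] at hwμ <;> omega
  have hw2 : w μ ≤ t := by
    rcases abs_cases (w μ) with ⟨h, _⟩ | ⟨h, _⟩ <;> rw [h] at hwμ <;> omega
  constructor <;> nlinarith

/-- `digit (aliasMom w) = w` for digits `w`. [cite: King1986, (4.2) p.670] -/
theorem digit_aliasMom (hN : Odd N) (q : Tor M) {w : Fin d → ℤ} (hw : w ∈ digitBox d N) :
    digit N M q (aliasMom N M q w) = w := by
  funext μ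
  have hM : (M μ : ℤ) ≠ 0 := by exact_mod_cast NeZero.ne (M μ)
  simp only [digit]
  rw [valMinAbs_aliasMom N M hN q hw μ, add_sub_cancel_left, Int.mul_ediv_cancel_left _ hM]

/-- **THE FIBRE IS THE DIGIT BOX**: `Σ_{p ∈ fib q} g(p) = Σ_{w ∈ digitBox} g(aliasMom q w)` (odd `N`) — King's
`Σ_l`, `l ∈ 2πℤ^d`, `|l_μ| ≦ π(L^k − 1)`, as a sum over the alias fibre of the torus. [cite: King1986, (4.2) p.670] -/
theorem sum_fib_eq_sum_digitBox (hN : Odd N) {β : Type*} [AddCommMonoid β] (q : Tor M)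
    (g : Tor (fine N M) → β) :
    ∑ p ∈ fib N M q, g p = ∑ w ∈ digitBox d N, g (aliasMom N M q w) := by
  refine Finset.sum_nbij' (digit N M q) (aliasMom N M q) ?_ ?_ ?_ ?_ ?_
  · intro p hp; exact digit_mem_digitBox N M hN hp
  · intro w _; exact aliasMom_mem_fib N M q w
  · intro p hp; exact aliasMom_digit N M hp
  · intro w hw; exact digit_aliasMom N M hN q hw
  · intro p hp; rw [aliasMom_digit N M hp]

end Digits

/-! ## §3 The dictionary: fine momentum, characters, symbols and alias weights of the fibre in King's variables -/

section Dictionary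

variable (N : ℕ) [NeZero N] (M : Fin d → ℕ) [hM : ∀ μ, NeZero (M μ)]

/-- **`N·θ_μ(p) = p′_μ + 2πj_μ`**: `N` times the fine reduced momentum of a fibre element is King's unit-lattice alias
momentum `p′ + l` (`p′ = sOf q`, `l = 2π·digit`). [cite: King1986, (4.2) p.670] -/
theorem natMul_sOf_fine_eq_aliasPt {q : Tor M} {p : Tor (fine N M)} (hp : p ∈ fib N M q) (μ : Fin d) :
    (N : ℝ) * sOf (fine N M) p μ = aliasPt (sOf M q) (digit N M q p) μ := by
  have hN : (N : ℝ) ≠ 0 := by exact_mod_cast NeZero.ne N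
  have hMμ : (M μ : ℝ) ≠ 0 := by exact_mod_cast NeZero.ne (M μ)
  have hv := valMinAbs_eq_of_mem_fib N M hp μ
  have hv' : (((p μ).valMinAbs : ℤ) : ℝ) = ((q μ).valMinAbs : ℝ) + (M μ : ℝ) * (digit N M q p μ : ℝ) := by
    exact_mod_cast hv
  simp only [sOf, aliasPt, fine]
  push_cast
  rw [hv']
  field_simp

/-- **The fine characters are the mode phases**: `e^{ip·x} = e^{iQ·ξ}` with `Q = p′ + 2πj` the alias momentum of `p` and
`ξ_μ = x_μ/N` the position in unit-lattice coordinates. [cite: King1986, (4.2) p.670] -/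
theorem chi_fine_eq_modePhase {q : Tor M} {p : Tor (fine N M)} (hp : p ∈ fib N M q) (x : Tor (fine N M)) :
    chi (fine N M) p x
      = modePhase (aliasPt (sOf M q) (digit N M q p)) (fun μ => ((x μ).val : ℝ) / N) := by
  have hN : (N : ℝ) ≠ 0 := by exact_mod_cast NeZero.ne N
  rw [chi_eq_cexp_sOf, modePhase]
  congr 3
  refine Finset.sum_congr rfl fun μ _ => ?_
  rw [← natMul_sOf_fine_eq_aliasPt N M hp μ]
  field_simp

/-- **The fine symbol is King's `Δ^η + m²` at the alias momentum**: for `c = N²`,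
`lapSym (Q/N) = Σ_μ 4N²sin²(Q_μ/2N) + m² = latticeSymbol N⁻¹ m² Q`. [cite: King1986, (4.4) p.670] -/
theorem lapSym_fine_eq_latticeSymbol {q : Tor M} {p : Tor (fine N M)} (hp : p ∈ fib N M q) (m2 : ℝ) :
    lapSym (fine N M) ((N : ℝ) ^ 2) m2 p
      = latticeSymbol (N : ℝ)⁻¹ m2 (aliasPt (sOf M q) (digit N M q p)) := by
  have hN : (N : ℝ) ≠ 0 := by exact_mod_cast NeZero.ne N
  unfold lapSym latticeSymbol fdSymbol
  rw [add_comm, Finset.mul_sum]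
  congr 1
  refine Finset.sum_congr rfl fun μ _ => ?_
  rw [← natMul_sOf_fine_eq_aliasPt N M hp μ]
  have h : (N : ℝ)⁻¹ * ((N : ℝ) * sOf (fine N M) p μ) / 2 = sOf (fine N M) p μ / 2 := by field_simp
  rw [h, Real.sin_sq_eq_half_sub, show 2 * (sOf (fine N M) p μ / 2) = sOf (fine N M) p μ by ring]
  field_simp
  ring

/-- One coordinate of the alias weight: the block average of a character is a geometric sum, and equals the complex
conjugate of King's factor `(e^{−iQ} − 1)·η·(e^{−iηQ} − 1)⁻¹` ((4.3)) at the alias momentum `Q = Nθ`, `η = N⁻¹`.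
[cite: King1986, (4.3) p.670] -/
theorem avgChar_eq_conj_uFac {q : Tor M} {p : Tor (fine N M)} (hp : p ∈ fib N M q) (μ : Fin d) :
    ((N : ℂ))⁻¹ * ∑ i : Fin N, (ZMod.stdAddChar (N := fine N M μ) (p μ * ((i : ℕ) : ZMod (fine N M μ))) : ℂ)
      = conj (uFac (N : ℝ)⁻¹ (aliasPt (sOf M q) (digit N M q p) μ)) := by
  have hN0 : N ≠ 0 := NeZero.ne N
  have hNr : (N : ℝ) ≠ 0 := by exact_mod_cast hN0
  have hNc : (N : ℂ) ≠ 0 := by exact_mod_cast hN0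
  set θ : ℝ := sOf (fine N M) p μ with hθ
  set Q : ℝ := aliasPt (sOf M q) (digit N M q p) μ with hQ
  have hQθ : Q = (N : ℝ) * θ := (natMul_sOf_fine_eq_aliasPt N M hp μ).symm
  -- each character value is `e^{iθ i}`
  have hchar : ∀ i : Fin N, (ZMod.stdAddChar (N := fine N M μ) (p μ * ((i : ℕ) : ZMod (fine N M μ))) : ℂ)
      = Complex.exp (Complex.I * (θ : ℂ)) ^ (i : ℕ) := by
    intro i
    rw [stdAddChar_mul_eq_cexp (fine N M) μ, ← Complex.exp_nat_mul]
    have hval : (((i : ℕ) : ZMod (fine N M μ))).val = (i : ℕ) := by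
      apply ZMod.val_natCast_of_lt
      have h1 : (i : ℕ) < N := i.isLt
      have h2 : N ≤ fine N M μ := by
        simp only [fine]; exact Nat.le_mul_of_pos_right _ (Nat.pos_of_ne_zero (NeZero.ne (M μ)))
      omega
    rw [hval]
    congr 1
    simp only [hθ, sOf]
    push_cast
    ring
  simp_rw [hchar]
  rw [Fin.sum_univ_eq_sum_range (fun i => Complex.exp (Complex.I * (θ : ℂ)) ^ i) N]
  by_cases hθ0 : θ = 0
  · -- trivial character: both sides are `1`
    have hQ0 : Q = 0 := by rw [hQθ, hθ0, mul_zero]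
    simp only [hθ0, Complex.ofReal_zero, mul_zero, Complex.exp_zero, one_pow, Finset.sum_const, Finset.card_range,
      nsmul_eq_mul, mul_one, inv_mul_cancel₀ hNc]
    rw [hQ0, uFac, if_pos rfl, map_one]
  · -- geometric sum
    have hθpi : |θ| ≤ π := abs_sOf_le (fine N M) p μ
    have hω : Complex.exp (Complex.I * (θ : ℂ)) ≠ 1 := by
      intro h
      rw [Complex.exp_eq_one_iff] at h
      obtain ⟨n, hn⟩ := h
      have hre := congrArg Complex.im hn
      simp only [Complex.mul_im, Complex.I_re, Complex.ofReal_im, mul_zero, Complex.I_im, Complex.ofReal_re, one_mul,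
        zero_add, Complex.mul_re, Complex.intCast_re, Complex.re_ofNat, Complex.intCast_im, Complex.im_ofNat,
        sub_zero, zero_mul, add_zero] at hre
      -- `θ = n·2π` with `|θ| ≤ π`, `θ ≠ 0`
      have hθn : θ = (n : ℝ) * (2 * π) := by linarith
      rcases lt_trichotomy n 0 with hn0 | hn0 | hn0
      · have : (n : ℝ) ≤ -1 := by exact_mod_cast (show n ≤ -1 by omega)
        have := abs_le.mp hθpi; nlinarith [Real.pi_pos]
      · exact hθ0 (by rw [hθn, hn0]; simp)
      · have : (1 : ℝ) ≤ n := by exact_mod_cast (show 1 ≤ n by omega)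
        have := abs_le.mp hθpi; nlinarith [Real.pi_pos]
    have hQ0 : Q ≠ 0 := by rw [hQθ]; exact mul_ne_zero hNr hθ0
    rw [geom_sum_eq hω]
    -- conjugate King's factor
    have hconj : ∀ z : ℂ, conj (Complex.exp (Complex.I * z)) = Complex.exp (Complex.I * (-conj z)) := by
      intro z; rw [← Complex.exp_conj, map_mul, Complex.conj_I]; ring_nf
    have hωbar : conj (Complex.exp (Complex.I * ((-(((N : ℝ))⁻¹ * Q) : ℝ) : ℂ))) = Complex.exp (Complex.I * (θ : ℂ)) := by
      rw [hconj, Complex.conj_ofReal, hQθ]; push_cast; field_simp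
    have hωN : conj (Complex.exp (Complex.I * ((-Q : ℝ) : ℂ))) = Complex.exp (Complex.I * (θ : ℂ)) ^ N := by
      rw [hconj, Complex.conj_ofReal, ← Complex.exp_nat_mul, hQθ]; push_cast; ring_nf
    -- conjugate King's factor explicitly
    rw [uFac, if_neg hQ0, fdq, map_div₀, map_sub, map_one, map_div₀, map_sub, map_one, hωN, hωbar,
      Complex.conj_ofReal]
    have hden : Complex.exp (Complex.I * (θ : ℂ)) - 1 ≠ 0 := sub_ne_zero.mpr hω
    push_cast
    field_simp

/-- **The torus alias weight IS King's (4.3), conjugated**: `u(p) = conj u^η_k(Q)` with `Q = p′ + 2πj` the alias momentum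
of `p ∈ fib q` and `η = N⁻¹` (`u^η_k = uWeight` of `AveragingWeightRate`). [cite: King1986, (4.3) p.670] -/
theorem u_eq_conj_uWeight {q : Tor M} {p : Tor (fine N M)} (hp : p ∈ fib N M q) :
    u N M p = conj (uWeight (N : ℝ)⁻¹ (aliasPt (sOf M q) (digit N M q p))) := by
  rw [u, sum_chi_offset_eq_prod, uWeight, map_prod]
  simp_rw [← avgChar_eq_conj_uFac N M hp]
  rw [Finset.prod_mul_distrib, Finset.prod_const, Finset.card_univ, Fintype.card_fin, inv_pow]

end Dictionary

/-! ## §4 The torus modes ARE King's modes; the minimiser kernel as a digit sum -/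

section Modes

variable (N : ℕ) [NeZero N] (M : Fin d → ℕ) [hM : ∀ μ, NeZero (M μ)]

/-- **One torus mode of (4.2) is King's mode**: for `p ∈ fib q`, `c = N²`, `a > 0`, `m² > 0`,
`Δ^{(k)}(q)·σ(p)⁻¹·conj u(p)·e^{−iq·b}·e^{ip·x} = e^{−iq·b}·modeTerm (Δ^{(k)}(p′)) N⁻¹ m² (p′ + 2πj) ξ` with `p′ = sOf q`,
`j = digit p`, `ξ = x/N` (`modeTerm` of `MinimizerAliasModes`, `Δ^{(k)} = DeltaEff`). [cite: King1986, (4.2)–(4.5) p.670] -/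
theorem torusMode_eq_modeTerm (hN1 : 1 ≤ N) {a m2 : ℝ} (ha : 0 < a) (hm : 0 < m2) {q : Tor M}
    {p : Tor (fine N M)} (hp : p ∈ fib N M q) (b : Tor M) (x : Tor (fine N M)) :
    ((effSym N M a ((N : ℝ) ^ 2) m2 q * (lapSym (fine N M) ((N : ℝ) ^ 2) m2 p)⁻¹ : ℝ) : ℂ)
        * conj (u N M p) * conj (chi M q b) * chi (fine N M) p x
      = conj (chi M q b)
        * modeTerm (DeltaEff a N m2 (sOf M q)) (N : ℝ)⁻¹ m2 (aliasPt (sOf M q) (digit N M q p))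
            (fun μ => ((x μ).val : ℝ) / N) := by
  rw [effSym_eq_DeltaEff N M hN1 ha hm, lapSym_fine_eq_latticeSymbol N M hp, u_eq_conj_uWeight N M hp,
    Complex.conj_conj, chi_fine_eq_modePhase N M hp, modeTerm]
  ring

/-- **THE MINIMISER KERNEL AS KING'S DOUBLE SUM (4.2)/(4.19)** on the torus (odd `N`, `c = N²`, `a > 0`, `m² > 0`):
`ℋ_k(x, b) = |Ω|⁻¹ Σ_{q} e^{−iq·b} Σ_{j ∈ digitBox} Δ^{(k)}(p′)·u^η(p′+2πj)·Δ^η(p′+2πj)⁻¹·e^{i(p′+2πj)·ξ}` — the average over the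
reduced momenta `p′ = sOf q` (King's `(2π)^{−d}∫dp′`) of the alias sum over `l = 2πj`, `|l_μ| ≦ π(N − 1)`.
[cite: King1986, (4.2) p.670, (4.19) p.672] -/
theorem minimiser_kernel_eq_digitSum (hN : Odd N) (hN1 : 1 ≤ N) {a m2 : ℝ} (ha : 0 < a) (hm : 0 < m2)
    (b : Tor M) (x : Tor (fine N M)) :
    ((minimiser N M a ((N : ℝ) ^ 2) m2 (Pi.single b 1) x : ℝ) : ℂ)
      = (Fintype.card (Tor M) : ℂ)⁻¹
        * ∑ q : Tor M, conj (chi M q b)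
            * ∑ w ∈ digitBox d N, modeTerm (DeltaEff a N m2 (sOf M q)) (N : ℝ)⁻¹ m2 (aliasPt (sOf M q) w)
                (fun μ => ((x μ).val : ℝ) / N) := by
  rw [minimiser_kernel_eq_sum N M ha.le (by positivity) hm]
  congr 1
  rw [← Finset.sum_fiberwise Finset.univ (red N M)
    (fun p => ((effSym N M a ((N : ℝ) ^ 2) m2 (red N M p) * (lapSym (fine N M) ((N : ℝ) ^ 2) m2 p)⁻¹ : ℝ) : ℂ)
      * conj (u N M p) * conj (chi M (red N M p) b) * chi (fine N M) p x)]
  refine Finset.sum_congr rfl fun q _ => ?_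
  have hfib : ∀ p ∈ fib N M q,
      ((effSym N M a ((N : ℝ) ^ 2) m2 (red N M p) * (lapSym (fine N M) ((N : ℝ) ^ 2) m2 p)⁻¹ : ℝ) : ℂ)
          * conj (u N M p) * conj (chi M (red N M p) b) * chi (fine N M) p x
        = conj (chi M q b) * modeTerm (DeltaEff a N m2 (sOf M q)) (N : ℝ)⁻¹ m2 (aliasPt (sOf M q) (digit N M q p))
            (fun μ => ((x μ).val : ℝ) / N) := by
    intro p hp
    have hq : red N M p = q := by simpa [fib] using hp
    rw [hq]
    exact torusMode_eq_modeTerm N M hN1 ha hm hp b x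
  rw [Finset.sum_congr rfl hfib, ← Finset.mul_sum, sum_fib_eq_sum_digitBox N M hN]
  congr 1
  refine Finset.sum_congr rfl fun w hw => ?_
  rw [digit_aliasMom N M hN q hw]

end Modes

/-! ## §5 Two levels of digits: `l + m`, `l ∈ 2πℤ^d` with `|l_μ| ≦ π(N−1)`, `m ∈ 2πNℤ^d` with `|m_μ| ≦ πN(R−1)` -/

section TwoLevel

/-- `(N·R)/2 = N·(R/2) + N/2` for odd `R` (the half-widths of the digit boxes add up). [folklore] -/
private theorem half_mul_of_odd (N : ℕ) {R : ℕ} (hR : Odd R) : N * R / 2 = N * (R / 2) + N / 2 := by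
  obtain ⟨s, hs⟩ := hR
  subst hs
  have : N * (2 * s + 1) = N + 2 * (N * s) := by ring
  rw [this, Nat.add_mul_div_left _ _ two_pos]
  have h2 : (2 * s + 1) / 2 = s := by omega
  rw [h2]; ring

/-- The combined digit `j + Nb` of `j ∈ digitBox N`, `b ∈ digitBox R` lies in `digitBox (NR)` (odd `R`).
[cite: King1986, (4.19) p.672] -/
theorem combo_mem_digitBox {N R : ℕ} (hR : Odd R) {j b : Fin d → ℤ} (hj : j ∈ digitBox d N)
    (hb : b ∈ digitBox d R) : j + (N : ℤ) • b ∈ digitBox d (N * R) := by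
  rw [mem_digitBox] at hj hb ⊢
  intro μ
  have h1 := hj μ
  have h2 := hb μ
  rw [half_mul_of_odd N hR]
  push_cast
  simp only [Pi.add_apply, Pi.smul_apply, smul_eq_mul]
  have hN0 : (0 : ℤ) ≤ N := Nat.cast_nonneg N
  calc |j μ + (N : ℤ) * b μ| ≤ |j μ| + |(N : ℤ) * b μ| := abs_add_le _ _
    _ = |j μ| + (N : ℤ) * |b μ| := by rw [abs_mul, abs_of_nonneg hN0]
    _ ≤ ((N / 2 : ℕ) : ℤ) + (N : ℤ) * ((R / 2 : ℕ) : ℤ) := add_le_add h1 (mul_le_mul_of_nonneg_left h2 hN0)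
    _ = (N : ℤ) * ((R / 2 : ℕ) : ℤ) + ((N / 2 : ℕ) : ℤ) := by ring

/-- **THE FINE DIGIT BOX IS THE PRODUCT OF THE COARSE BOX AND THE EXTRA DIGITS**: for odd `N`, `R`,
`Σ_{w ∈ digitBox(NR)} F(w) = Σ_{j ∈ digitBox N} Σ_{b ∈ digitBox R} F(j + Nb)` — King's re-indexing of the aliases of the
finer lattice as `l + m`, `l ∈ 2πℤ^d`, `m ∈ 2πL^kℤ^d` ((4.19); injectivity = `AliasSums.digits_injective_pi`, the count
`N^dR^d = (NR)^d`). [cite: King1986, (4.19) p.672] -/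
theorem sum_digitBox_mul {N R : ℕ} (hN : Odd N) (hR : Odd R) {β : Type*} [AddCommMonoid β]
    (F : (Fin d → ℤ) → β) :
    ∑ w ∈ digitBox d (N * R), F w = ∑ j ∈ digitBox d N, ∑ b ∈ digitBox d R, F (j + (N : ℤ) • b) := by
  set φ : (Fin d → ℤ) × (Fin d → ℤ) → (Fin d → ℤ) := fun jb => jb.1 + (N : ℤ) • jb.2 with hφ
  have hinj : Set.InjOn φ ↑(digitBox d N ×ˢ digitBox d R) := by
    rintro ⟨j, b⟩ hjb ⟨j', b'⟩ hjb' h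
    simp only [Finset.coe_product, Set.mem_prod, Finset.mem_coe] at hjb hjb'
    obtain ⟨h1, h2⟩ := digits_injective_pi (two_abs_lt_of_mem_digitBox N hN hjb.1)
      (two_abs_lt_of_mem_digitBox N hN hjb'.1) h
    exact Prod.ext h1 h2
  have himage : (digitBox d N ×ˢ digitBox d R).image φ = digitBox d (N * R) := by
    apply Finset.eq_of_subset_of_card_le
    · intro w hw
      rw [Finset.mem_image] at hw
      obtain ⟨⟨j, b⟩, hjb, rfl⟩ := hw
      rw [Finset.mem_product] at hjb
      exact combo_mem_digitBox hR hjb.1 hjb.2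
    · rw [Finset.card_image_of_injOn hinj, Finset.card_product, card_digitBox N hN, card_digitBox R hR,
        card_digitBox (N * R) (hN.mul hR), mul_pow]
  rw [← himage, Finset.sum_image hinj, Finset.sum_product]

end TwoLevel

end Torus

end Literature.MathematicalPhysics.QuantumFieldTheory.King1986
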